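import Literature.MathematicalPhysics.QuantumLattice.ShiftedWickDeterminant
import Literature.MathematicalPhysics.QuantumLattice.BdGBondHamiltonianParticleHole

/-!
# The renormalised (tadpole-subtracted) perturbation series of the Hubbard partition function,
# coefficients as shifted fermionic determinants

For an interacting lattice fermion system whose interaction is written with SHIFTED quadratic
factors — `H = dΓ(h) + g Σ_r v_r (c†_{p₁r}c_{q₁r} − ν₁r)(c†_{p₂r}c_{q₂r} − ν₂r)` — the Dyson series
of `Tr e^{−βH}` in `g` has, as its `k`-th coefficient, an ordered imaginary-time integral of free
expectations of ordered products of SHIFTED evolved pairs `a⁺a⁻(s) − ν`; by the shifted Wick theorem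
(`ShiftedWickDeterminant`) these are determinants of the pair-indexed free propagator matrix with the
shifts subtracted on the diagonal. For the Hubbard model this is the expansion with Hartree /
chemical-potential counterterms: writing `U n↑n↓ = U(n↑ − ν)(n↓ − ν) + Uν(n↑ + n↓) − Uν²`, the model at
chemical potential `μ + Uν` is the free gas at `μ` perturbed by `U Σ_x (n_{x↑} − ν)(n_{x↓} − ν)` (up to
the constant `Uν²|Λ|`), and its partition function is an entire series in `U` with coefficients
`Z₀ · det (G − ν·1)` — BGM 2006 §2 (there `ν` is the counterterm fixing the interacting Fermi surface).

* `hasSum_dyson_partitionFn_shiftedQuartic` — the Dyson series for a general shifted quartic family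
  (operator level, any finite `ι`);
* `gibbsState_dGamma_prod_shiftedHubbardVertex_eq_det` — the free expectation of
  `∏ᵢ (n_{xᵢ↑}(sᵢ) − ν₀)(n_{xᵢ↓}(sᵢ) − ν₁)` is `det (propMatrix − diagonal ν)` (`2k` pairs);
* `hasSum_shiftedHubbard_partitionFn_det` — the series of `Tr e^{−β(dΓ(h_μ) + UΣ_x(n_{x↑}−ν₀)(n_{x↓}−ν₁))}`
  with determinant coefficients;
* `dGamma_hubbardOneBody_add_smul_sum_shiftedVertex` — for equal real shifts the shifted Hamiltonian
  is `hamiltonianWith G t U (μ + Uν) + Uν²|Λ|`, whence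
* `hasSum_hubbard_partitionFn_renormalised_det` —
  `Σ_k U^k (−β)^k ∫ Σ_{x⃗} Z₀(μ) det (G_k(x⃗,u; μ) − ν·1) du = e^{−βUν²|Λ|} Z(β; H(t,U) − (μ + Uν)N)`.

## References
* G. Benfatto, A. Giuliani, V. Mastropietro, Ann. Henri Poincaré 7 (2006) 809, §2 (determinant
  expansion with the counterterm `ν`). [cite: BenfattoGiulianiMastropietro2006, §2]
* M. Gaudin, Nucl. Phys. 15 (1960) 89. [cite: Gaudin1960]
-/

noncomputable section

namespace Literature.MathematicalPhysics.QuantumLattice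

open NormedSpace Matrix Finset
open scoped ComplexOrder

/-! ### Conjugating shifted operators -/

section Conj

variable {m : Type*} [Fintype m] [DecidableEq m]

/-- Conjugation fixes central shifts: `e^{X}(Y − c·1)e^{−X} = e^{X}Ye^{−X} − c·1`. [folklore] -/
theorem exp_mul_sub_smul_one_mul_exp_neg (X Y : Matrix m m ℂ) (c : ℂ) :
    exp X * (Y - c • (1 : Matrix m m ℂ)) * exp (-X) = exp X * Y * exp (-X) - c • 1 := by
  have h1 : exp X * exp (-X) = 1 := by
    rw [← Matrix.exp_add_of_commute _ _ (Commute.refl X).neg_right, add_neg_cancel, exp_zero]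
  rw [mul_sub, sub_mul, Matrix.mul_smul, Matrix.mul_one, Matrix.smul_mul, h1]

end Conj

/-! ### The Dyson series of a shifted quartic perturbation -/

section ShiftedQuartic

variable {ι : Type*} [LinearOrder ι] [Fintype ι]

/-- **Dyson series of the partition function for a SHIFTED quartic perturbation.** For a one-body
matrix `h` (`H₀ = dΓ(h)`), a perturbation `V = Σ_r v_r (c†_{p₁r}c_{q₁r} − ν₁r·1)(c†_{p₂r}c_{q₂r} − ν₂r·1)`
with complex shifts `ν₁, ν₂`, and every complex `g`:
`Tr e^{−β(H₀+gV)} = Σ_k g^k (−β)^k ∫_{0≤u₀≤⋯≤u_{k−1}≤1} Σ_f (∏ᵢ v_{f i}) ·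
  Tr(e^{−βH₀} ∏ᵢ (a⁺_{p₁fi}(sᵢ)a⁻_{q₁fi}(sᵢ) − ν₁(fi))(a⁺_{p₂fi}(sᵢ)a⁻_{q₂fi}(sᵢ) − ν₂(fi))) du`,
`sᵢ = −βuᵢ`, `a^±(s) = e^{sH₀}c^±e^{−sH₀}` — conjugation by `e^{sH₀}` is multiplicative and fixes the
shifts. BGM 2006 §2.1 (2.6) with counterterms. [cite: BenfattoGiulianiMastropietro2006, §2.1 (2.6)] -/
theorem hasSum_dyson_partitionFn_shiftedQuartic {R : Type*} [Fintype R] (β : ℝ) (h : Matrix ι ι ℂ)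
    (v : R → ℂ) (p₁ q₁ p₂ q₂ : R → ι) (ν₁ ν₂ : R → ℂ) (g : ℂ) :
    HasSum (fun k : ℕ => g ^ k * orderedIntegral k
      (fun u : Fin k → ℝ =>
        (-(β : ℂ)) ^ k * ∑ f : Fin k → R, (∏ i, v (f i)) *
          (Matrix.gibbsWeight β (dGamma h) *
            (List.ofFn fun i : Fin k =>
              ((exp ((((u i : ℝ) : ℂ) * -(β : ℂ)) • dGamma h) * creation (p₁ (f i)) * exp (-((((u i : ℝ) : ℂ) * -(β : ℂ)) • dGamma h))) * (exp ((((u i : ℝ) : ℂ) * -(β : ℂ)) • dGamma h) * annihilation (q₁ (f i)) * exp (-((((u i : ℝ) : ℂ) * -(β : ℂ)) • dGamma h))) -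
                  ν₁ (f i) • (1 : Matrix (Finset ι) (Finset ι) ℂ)) *
                ((exp ((((u i : ℝ) : ℂ) * -(β : ℂ)) • dGamma h) * creation (p₂ (f i)) * exp (-((((u i : ℝ) : ℂ) * -(β : ℂ)) • dGamma h))) * (exp ((((u i : ℝ) : ℂ) * -(β : ℂ)) • dGamma h) * annihilation (q₂ (f i)) * exp (-((((u i : ℝ) : ℂ) * -(β : ℂ)) • dGamma h))) -
                  ν₂ (f i) • (1 : Matrix (Finset ι) (Finset ι) ℂ))).prod).trace) 1)
      (Matrix.partitionFn β (dGamma h + g • ∑ r, v r •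
          ((creation (p₁ r) * annihilation (q₁ r) - ν₁ r • 1) *
            (creation (p₂ r) * annihilation (q₂ r) - ν₂ r • 1)))) := by
  have hs := hasSum_dyson_trace_gibbsWeight_sum β (dGamma h) 1 v
    (fun r => (creation (p₁ r) * annihilation (q₁ r) - ν₁ r • 1) *
      (creation (p₂ r) * annihilation (q₂ r) - ν₂ r • 1)) g
  simp only [exp_mul_mul_mul_exp_neg, exp_mul_sub_smul_one_mul_exp_neg, Matrix.one_mul,
    Matrix.mul_one] at hs
  exact hs

end ShiftedQuartic

/-! ### The Hubbard model with shifted densities: determinant coefficients -/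

section ShiftedHubbard

variable {Λ : Type*} [LinearOrder Λ] [Fintype Λ]

/-- **The free expectations in the shifted Dyson coefficients are shifted determinants**: for a
Hermitian one-body matrix `h` on `Orb Λ`, vertex sites `xᵢ = f i`, pair times `sᵢ` and shifts
`ν₀, ν₁` (for the spin-`0` and spin-`1` densities),
`⟨∏ᵢ (a⁺_{xᵢ↑}(sᵢ)a⁻_{xᵢ↑}(sᵢ) − ν₀)(a⁺_{xᵢ↓}(sᵢ)a⁻_{xᵢ↓}(sᵢ) − ν₁)⟩_{β,dΓ(h)} = det (G − D)`, with `G`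
the `2k × 2k` pair-indexed propagator matrix (`propMatrix`; position `2i + j` ↔ orbital `(xᵢ, j)` at
time `sᵢ`) and `D = diagonal (2i + j ↦ ν_j)` — the shifted Wick theorem regrouped into vertices.
BGM 2006 §2.1 (2.6) with counterterms. [cite: BenfattoGiulianiMastropietro2006, §2.1 (2.6)] -/
theorem gibbsState_dGamma_prod_shiftedHubbardVertex_eq_det {h : Matrix (Orb Λ) (Orb Λ) ℂ}
    (hh : h.IsHermitian) (β : ℝ) {k : ℕ} (f : Fin k → Λ) (s : Fin k → ℂ) (ν : Fin 2 → ℂ) :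
    gibbsState β (dGamma h)
        (List.ofFn fun i : Fin k =>
          ((exp (s i • dGamma h) * creation (orb (f i) 0) * exp (-(s i • dGamma h))) *
                (exp (s i • dGamma h) * annihilation (orb (f i) 0) * exp (-(s i • dGamma h))) -
              ν 0 • (1 : Matrix (Finset (Orb Λ)) (Finset (Orb Λ)) ℂ)) *
            ((exp (s i • dGamma h) * creation (orb (f i) 1) * exp (-(s i • dGamma h))) *
                (exp (s i • dGamma h) * annihilation (orb (f i) 1) * exp (-(s i • dGamma h))) -
              ν 1 • (1 : Matrix (Finset (Orb Λ)) (Finset (Orb Λ)) ℂ))).prod =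
      (propMatrix β h
          (fun m : Fin (k * 2) => orb (f (finProdFinEquiv.symm m).1) (finProdFinEquiv.symm m).2)
          (fun m : Fin (k * 2) => orb (f (finProdFinEquiv.symm m).1) (finProdFinEquiv.symm m).2)
          (fun m : Fin (k * 2) => s (finProdFinEquiv.symm m).1) -
        Matrix.diagonal (fun m : Fin (k * 2) => ν (finProdFinEquiv.symm m).2)).det := by
  have key := gibbsState_dGamma_prod_evolved_sub_smul_eq_det hh β
    (fun m : Fin (k * 2) => orb (f (finProdFinEquiv.symm m).1) (finProdFinEquiv.symm m).2)
    (fun m : Fin (k * 2) => orb (f (finProdFinEquiv.symm m).1) (finProdFinEquiv.symm m).2)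
    (fun m : Fin (k * 2) => s (finProdFinEquiv.symm m).1)
    (fun m : Fin (k * 2) => ν (finProdFinEquiv.symm m).2)
  rw [prod_ofFn_mul_two] at key
  simp only [Equiv.symm_apply_apply] at key
  exact key

variable (G : SimpleGraph Λ) [DecidableRel G.Adj]

/-- **The shifted perturbation series of the Hubbard partition function in determinant form.** On any
finite graph, for real `β, t, U, μ` and complex shifts `ν₀, ν₁`, with `h = hubbardOneBody G t μ`,
`Z₀ = Tr e^{−β dΓ(h)}`:
`Tr e^{−β(dΓ(h) + U Σ_x (n_{x↑} − ν₀)(n_{x↓} − ν₁))} = Σ_k U^k (−β)^k ∫_{0≤u₀≤⋯≤u_{k−1}≤1} Σ_{x⃗ ∈ Λ^k}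
  Z₀ det (G_k(x⃗, u) − D) du`, `G_k` the `2k × 2k` propagator matrix of the vertex pairs at times
`sᵢ = −βuᵢ`, `D = diagonal (2i + j ↦ ν_j)`; an entire series in `U` in finite volume.
BGM 2006 §2.1 (2.6) with the counterterm on the diagonal. [cite: BenfattoGiulianiMastropietro2006, §2.1 (2.6)] -/
theorem hasSum_shiftedHubbard_partitionFn_det (β t U μ : ℝ) (ν : Fin 2 → ℂ) :
    HasSum (fun k : ℕ => (U : ℂ) ^ k * orderedIntegral k (fun u : Fin k → ℝ =>
        (-(β : ℂ)) ^ k * ∑ f : Fin k → Λ, Matrix.partitionFn β (dGamma (hubbardOneBody G t μ)) *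
          (propMatrix β (hubbardOneBody G t μ)
              (fun m : Fin (k * 2) => orb (f (finProdFinEquiv.symm m).1) (finProdFinEquiv.symm m).2)
              (fun m : Fin (k * 2) => orb (f (finProdFinEquiv.symm m).1) (finProdFinEquiv.symm m).2)
              (fun m : Fin (k * 2) => (((u (finProdFinEquiv.symm m).1 : ℝ) : ℂ) * -(β : ℂ))) -
            Matrix.diagonal (fun m : Fin (k * 2) => ν (finProdFinEquiv.symm m).2)).det) 1)
      (Matrix.partitionFn β (dGamma (hubbardOneBody G t μ) + (U : ℂ) • ∑ x : Λ,
        ((numberOp x 0 - ν 0 • 1) * (numberOp x 1 - ν 1 • 1)))) := by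
  haveI : Nonempty (Finset (Orb Λ)) := ⟨∅⟩
  have hZ : Matrix.partitionFn β (dGamma (hubbardOneBody G t μ)) ≠ 0 :=
    (Matrix.partitionFn_pos β (isHermitian_dGamma (isHermitian_hubbardOneBody G t μ))).ne'
  have hs := hasSum_dyson_partitionFn_shiftedQuartic β (hubbardOneBody G t μ) (fun _ : Λ => (1 : ℂ))
    (fun z => orb z 0) (fun z => orb z 0) (fun z => orb z 1) (fun z => orb z 1)
    (fun _ => ν 0) (fun _ => ν 1) (U : ℂ)
  simp only [Finset.prod_const_one, one_mul, one_smul] at hs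
  simp only [numberOp]
  refine hs.congr_fun fun k => ?_
  refine congrArg (fun F => (U : ℂ) ^ k * orderedIntegral k F 1) (funext fun u => ?_)
  refine congrArg (fun S => (-(β : ℂ)) ^ k * S) (Finset.sum_congr rfl fun f _ => ?_)
  rw [← gibbsState_dGamma_prod_shiftedHubbardVertex_eq_det (isHermitian_hubbardOneBody G t μ) β f
    (fun i : Fin k => ((u i : ℝ) : ℂ) * -(β : ℂ)) ν, Matrix.gibbsState_apply, mul_inv_cancel_left₀ hZ]

/-- **Equal real shifts = a shifted chemical potential plus a constant.** With `ν₀ = ν₁ = ν ∈ ℝ`: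
`dΓ(h_μ) + U Σ_x (n_{x↑} − ν)(n_{x↓} − ν) = (H(t,U) − (μ + Uν)N) + Uν²|Λ|·1`
(`U n↑n↓ = U(n↑ − ν)(n↓ − ν) + Uν(n↑ + n↓) − Uν²` summed over the sites). BGM 2006 §2 (the
counterterm shifts the chemical potential). [cite: BenfattoGiulianiMastropietro2006, §2] -/
theorem dGamma_hubbardOneBody_add_smul_sum_shiftedVertex (t U μ ν : ℝ) :
    dGamma (hubbardOneBody G t μ) + (U : ℂ) • ∑ x : Λ,
        ((numberOp x 0 - (ν : ℂ) • 1) * (numberOp x 1 - (ν : ℂ) • 1)) =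
      hamiltonianWith G t U (μ + U * ν) + ((U * ν ^ 2 * Fintype.card Λ : ℝ) : ℂ) • 1 := by
  -- expand the shifted vertices
  have hvertex : ∀ x : Λ, (numberOp x 0 - (ν : ℂ) • (1 : Matrix (Finset (Orb Λ)) (Finset (Orb Λ)) ℂ)) *
      (numberOp x 1 - (ν : ℂ) • 1) =
        numberOp x 0 * numberOp x 1 - (ν : ℂ) • (numberOp x 0 + numberOp x 1) +
          ((ν : ℂ) * ν) • (1 : Matrix (Finset (Orb Λ)) (Finset (Orb Λ)) ℂ) := by
    intro x
    simp only [sub_mul, mul_sub, Matrix.mul_smul, Matrix.mul_one, Matrix.smul_mul, Matrix.one_mul,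
      smul_smul, smul_add]
    abel
  simp_rw [hvertex]
  rw [Finset.sum_add_distrib, Finset.sum_sub_distrib, Finset.sum_const, Finset.card_univ,
    ← Finset.smul_sum, smul_add, smul_sub]
  -- the unshifted part is `hamiltonianWith G t U μ`
  have hN : ∑ x : Λ, (numberOp x 0 + numberOp x 1) = (totalNumber : Matrix (Finset (Orb Λ)) (Finset (Orb Λ)) ℂ) := by
    rw [totalNumber]
    refine Finset.sum_congr rfl fun x _ => ?_
    rw [Fin.sum_univ_two]
  have hW : hamiltonianWith G t U μ = dGamma (hubbardOneBody G t μ) + (U : ℂ) • ∑ x : Λ,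
      numberOp x 0 * numberOp x 1 := by
    rw [hamiltonianWith_eq_dGamma_add_smul]; rfl
  have hμ : hamiltonianWith G t U (μ + U * ν) = hamiltonianWith G t U μ - ((U * ν : ℝ) : ℂ) • totalNumber := by
    rw [hamiltonianWith_eq, hamiltonianWith_eq, Complex.ofReal_add, add_smul]
    abel
  rw [hμ, hW, hN, ← Nat.cast_smul_eq_nsmul ℂ (Fintype.card Λ), smul_smul, smul_smul, smul_smul]
  have e1 : ((U : ℝ) : ℂ) * ((Fintype.card Λ : ℕ) : ℂ) * ((ν : ℂ) * ν) =
      ((U * ν ^ 2 * Fintype.card Λ : ℝ) : ℂ) := by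
    push_cast; ring
  rw [e1]
  push_cast
  abel

/-- **The renormalised perturbation series of the Hubbard partition function (finite volume,
determinant form).** For real `β, t, U, μ, ν`, with the FREE one-body matrix at chemical potential
`μ` (`h = hubbardOneBody G t μ`, `Z₀ = Tr e^{−βdΓ(h)}`) and the INTERACTING model at the shifted
chemical potential `μ + Uν`:
`Σ_k U^k (−β)^k ∫_{0≤u₀≤⋯≤u_{k−1}≤1} Σ_{x⃗ ∈ Λ^k} Z₀ det (G_k(x⃗, u) − ν·1) du
  = e^{−βUν²|Λ|} · Tr e^{−β(H(t,U) − (μ+Uν)N)}` — the expansion in `U` at fixed free Fermi surface with the Hartree /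
chemical-potential counterterm `ν` subtracted on the diagonal of every fermionic determinant; entire
in `U` in finite volume. BGM 2006 §2. [cite: BenfattoGiulianiMastropietro2006, §2] -/
theorem hasSum_hubbard_partitionFn_renormalised_det (β t U μ ν : ℝ) :
    HasSum (fun k : ℕ => (U : ℂ) ^ k * orderedIntegral k (fun u : Fin k → ℝ =>
        (-(β : ℂ)) ^ k * ∑ f : Fin k → Λ, Matrix.partitionFn β (dGamma (hubbardOneBody G t μ)) *
          (propMatrix β (hubbardOneBody G t μ)
              (fun m : Fin (k * 2) => orb (f (finProdFinEquiv.symm m).1) (finProdFinEquiv.symm m).2)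
              (fun m : Fin (k * 2) => orb (f (finProdFinEquiv.symm m).1) (finProdFinEquiv.symm m).2)
              (fun m : Fin (k * 2) => (((u (finProdFinEquiv.symm m).1 : ℝ) : ℂ) * -(β : ℂ))) -
            (ν : ℂ) • (1 : Matrix (Fin (k * 2)) (Fin (k * 2)) ℂ)).det) 1)
      ((Real.exp (-(β * (U * ν ^ 2 * Fintype.card Λ))) : ℂ) *
        Matrix.partitionFn β (hamiltonianWith G t U (μ + U * ν))) := by
  -- scalar shifts of the Hamiltonian: `Z(K + r) = e^{-βr} Z(K)`
  have hshift : ∀ (K : Matrix (Finset (Orb Λ)) (Finset (Orb Λ)) ℂ) (r : ℝ),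
      Matrix.partitionFn β (K + (r : ℂ) • 1) = (Real.exp (-(β * r)) : ℂ) * Matrix.partitionFn β K := by
    intro K r
    rw [Matrix.partitionFn, Matrix.partitionFn, gibbsWeight_add_smul_one, Matrix.trace_smul, smul_eq_mul]
    congr 1
    rw [Complex.ofReal_exp]
    push_cast
    ring_nf
  have hs := hasSum_shiftedHubbard_partitionFn_det G β t U μ (fun _ => (ν : ℂ))
  beta_reduce at hs
  rw [dGamma_hubbardOneBody_add_smul_sum_shiftedVertex, hshift] at hs
  have hdiag : ∀ k : ℕ, (Matrix.diagonal fun _ : Fin (k * 2) => (ν : ℂ)) =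
      (ν : ℂ) • (1 : Matrix (Fin (k * 2)) (Fin (k * 2)) ℂ) := fun k => (smul_one_eq_diagonal (ν : ℂ)).symm
  simp only [hdiag] at hs
  exact hs

end ShiftedHubbard

end Literature.MathematicalPhysics.QuantumLattice
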